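import Mathlib
import HarnessLib
import HarnessLib.Audit
import Summits.AtomisticToContinuum.Statement
import Literature.MathematicalPhysics.QuantumManyBody.PeriodicBoseGas
import Literature.MathematicalPhysics.QuantumManyBody.WeightedCorrector
import HarnessLib.Audit.Status.Attr

/-!
Route: BECInsertionCorrector

DORMANT since 2026-08-25T17:34:28Z (reconciler: no traction for 7.9 d (last activity item-evidence-added at 2026-08-17T19:19:33Z); parked, not closed — `ledger route dormant route-AtomisticToContinuum-BECInsertionCorrector --off` to rea) — unstaffed, not closed; items shared with open routes are served there. `ledger route dormant <id> --off` reactivates.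

# Route BECInsertionCorrector — recoil regularises the infrared — Kipnis–Varadhan correctors of the
insertion amplitude h = Ψ_(N+1)/Ψ_N give torus BEC from a static response bound (conforming re-open
of BECRecoilCorrector)

Conforming re-open (D-0027 §2.1) of route BECRecoilCorrector (retired 2026-08-15T13:40Z
"not-a-thesis": its Assembly concluded the
Literature decl and no deciding theorem existed): same line, cruxes re-audited, target weakened to
its existential form, the Kipnis–Varadhan
bridge now TYPED over `hMinusOneSqW` (WeightedCorrector layer, landed since), and `closes` concludes
`_root_.BoseEinsteinCondensation`.
It suffices to show X = INSERTION RESIDUE (card kv-insertion-corrector, the output of its K1 + K2):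
for every repulsive finite-range v there
is ρ₀ > 0 such that for 0 < ρ < ρ₀ there is c > 0 with: for all large N there are δ > 0 and a
δ-near-minimiser Θ of the PERIODIC N-body
energy on the torus of side L = ((N+1)/ρ)^(1/3) such that every δ-near-minimiser Ψ of the periodic
(N+1)-body energy on the same torus has
|⟨φ₀ ⊗ Θ, Ψ⟩|² = L⁻³ |∫_(cell^N) conj Θ(X) ∫_cell Ψ(x, X) dx dX|² ≥ c (φ₀ = L^(-3/2) the constant
mode): adding ONE zero-momentum particle
to the N-body ground state lands on the (N+1)-body ground state with overlap bounded below — no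
orthogonality catastrophe in the insertion
channel (quasi-particle residue Z_N ≥ c at k = 0). X ⇒ torus BEC of near-minimisers by
Cauchy–Schwarz (support ResidueCondenses), and
the shared transfer crux BoundaryTransferWeak (stmt-AtomisticToContinuum-0827) gives the Dirichlet
conjunct. X itself is to come as
StaticResponseBound → InsertionResidue (crux CorrectorClosure): h := Ψ_(N+1)/Ψ_N > 0 solves the
EXACT linear eigen-equation
(−G_N − Δ_y + Σ_j v(y−x_j)) h = μ_N h over the ground-state diffusion G_N of the N-gas (reversible,
gapless, invariant law |Ψ_N|²dX),
Z_N = (E h)²/E h², and −log h is expanded in Kipnis–Varadhan correctors χ₁ = (−G_N−Δ_y)⁻¹W̃, χ₂ =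
(−G_N−Δ_y)⁻¹(|∇χ₁|² − E|∇χ₁|²), …
whose norms are controlled by the STATIC density response of the bath alone because the added
particle's recoil k² regularises ω → 0:
(ω + k²)⁻² ≤ (4ωk²)⁻¹ gives ‖χ₁‖² ≤ (ρ/4)∫|v̂(k)|² m₋₁(k) k⁻² d³k/(2π)³, finite in d = 3 iff m₋₁(k)
= ∫S(k,ω)ω⁻¹dω stays bounded as k → 0,
while ‖∇χ₁‖² = ‖W̃‖²_(H₋₁) ≤ ρ∫|v̂(k)|² m₋₁(k) d³k/(2π)³ is of the size of the EXACT identity E|∇log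
h|² = ρ_N∫v − μ_N (Born minus chemical
potential, soft v), the expansion's energy parameter.
Lean: `∀ v : ℝ → ENNReal,
Literature.MathematicalPhysics.QuantumManyBody.BoseGas.IsRepulsiveFiniteRange v → ∃ ρ₀ : ℝ, 0 < ρ₀ ∧
∀ ρ : ℝ, 0 < ρ → ρ < ρ₀ → ∃ c : ℝ, 0 < c ∧ ∀ᶠ N : ℕ in Filter.atTop, ∃ δ : ENNReal, 0 < δ ∧ ∃ Θ :
Literature.MathematicalPhysics.QuantumManyBody.BoseGas.PeriodicTrialState N
(Literature.MathematicalPhysics.QuantumManyBody.BoseGas.sideLength ρ (N + 1)),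
Literature.MathematicalPhysics.QuantumManyBody.BoseGas.periodicEnergy v Θ ≤
Literature.MathematicalPhysics.QuantumManyBody.BoseGas.periodicGroundStateEnergy v N
(Literature.MathematicalPhysics.QuantumManyBody.BoseGas.sideLength ρ (N + 1)) + δ ∧ ∀ Ψ :
Literature.MathematicalPhysics.QuantumManyBody.BoseGas.PeriodicTrialState (N + 1)
(Literature.MathematicalPhysics.QuantumManyBody.BoseGas.sideLength ρ (N + 1)),
Literature.MathematicalPhysics.QuantumManyBody.BoseGas.periodicEnergy v Ψ ≤
Literature.MathematicalPhysics.QuantumManyBody.BoseGas.periodicGroundStateEnergy v (N + 1)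
(Literature.MathematicalPhysics.QuantumManyBody.BoseGas.sideLength ρ (N + 1)) + δ → ENNReal.ofReal c
≤ ENNReal.ofReal ((Literature.MathematicalPhysics.QuantumManyBody.BoseGas.sideLength ρ (N + 1) ^
3)⁻¹) * (‖∫ X in Literature.MathematicalPhysics.QuantumManyBody.BoseGas.cellN N
(Literature.MathematicalPhysics.QuantumManyBody.BoseGas.sideLength ρ (N + 1)), conj (Θ.ψ X) * ∫ x in
Literature.MathematicalPhysics.QuantumManyBody.BoseGas.cell
(Literature.MathematicalPhysics.QuantumManyBody.BoseGas.sideLength ρ (N + 1)), Ψ.ψ (Matrix.vecCons x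
X)‖₊ : ENNReal) ^ 2`

## Assembly
Pure logic (sorry-free in Sketch.lean, axioms propext/choice/Quot.sound): CorrectorClosure turns
StaticResponseBound into InsertionResidue,
ResidueCondenses turns that into torus BEC of near-minimisers for every admissible v, and
BoundaryTransferWeak applied per potential yields
HasGroundStateBEC v ρ for ρ < ρ₀(v), i.e. `_root_.BoseEinsteinCondensation` (the audited sub-problem
abbrev, by name). Deciding theorem
(glue.lean): `theorem closes (h₁ : StaticResponseBound) (h₂ : CorrectorClosure) (h₃ :
ResidueCondenses) (h₄ : BoundaryTransferWeak) :
_root_.BoseEinsteinCondensation := fun v hv => h₄ v hv (h₃ (h₂ h₁) v hv)`. InsertionResidue (target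
= what the chain reaches),
StaticResponseToHMinusOne and DirichletRemovalBound (lemmas for the engine / the fallback) are not
hypotheses of `closes`.

Rationale: WHY THIS LINE. The mechanism is homogenisation theory's (imported area: probability / reversible
Markov processes): Kipnis–Varadhan, De Masi–Ferrari–
Goldstein–Wick, Osada and Kipnis–Landim solve Poisson (corrector) equations for additive functionals
of a reversible GAPLESS environment in
H₋₁ and never need a spectral gap (KipnisVaradhan1986, Osada1998, GuoPapanicolaouVaradhan1988,
KipnisLandim1999; quantitative form
GloriaOtto2011, GloriaMourrat2013); Spohn1987 / DybalskiSpohn2020 / MukherjeeVaradhan2019 /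
doi:10.1214/25-aop1791 already point that
machinery at a quantum ground-state question (polaron effective mass = CLT variance of the
ground-state-transformed process). Here the
environment is the interacting N-boson ground state itself, the tagged particle is the (N+1)-st
boson, the additive functional is
W̃ = Σ_j v(y−x_j) − ρ∫v, and the target is not a diffusivity but FLATNESS of the principal
eigenfunction h (Z_N ≥ c, the insertion form of
the condensate criterion, PenroseOnsager1956 / Reatto1969); the one estimate imported from Bose-gas
energy technology is the static response
bound (second-order energy response to tΣcos(k·x_j): FournaisSolovej2020, Fournais2020,
doi:10.1007/s00023-021-01151-z,
doi:10.1016/j.matpur.2023.06.002), which is exactly what makes the FIRST corrector bounded uniformly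
in L — GuentherEtAl2021: the bosonic
orthogonality catastrophe occurs iff the bath is ideal, i.e. infinitely compressible. Unlike the
open routes (energy windows, landscape /
policy iteration on the full log Ψ₀, RP anchors, SOS certificates) nothing here expands −log Ψ₀
itself or books a gap: the true ground
states enter through ONE eigen-equation for the N → N+1 increment and positivity, outside
KineticGapLengthScalesNarrow's energy-window class,
and the expansion is in DENSITY functionals with derivative vertices, the IR-finite side of
BogoliubovPerturbationInfraredNarrow; the energy→H₋₁
dictionary is filed as a typed, provable-now support (StaticResponseToHMinusOne) over
Literature.MathematicalPhysics.QuantumManyBody.BoseGas.hMinusOneSqW.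

RANKED CRUXES. #0 InsertionResidue (target) — X as in § Thesis — uniformly positive zero-momentum
insertion overlap |⟨φ₀⊗Θ, Ψ⟩|² ≥ c between SOME δ-near-minimiser Θ of the periodic N-body energy and
EVERY δ-near-minimiser Ψ of the periodic (N+1)-body energy on the torus of side ((N+1)/ρ)^(1/3), ρ <
ρ₀(v), N large (card K3 target quantity; Bogoliubov: Z_N = 1 − O(√(ρa³))). Existential in Θ (weaker
than the retired route's ∀Θ, immune to N-body ground-state degeneracy; ResidueCondenses needs only
one normalised Θ). (why it might fail: Z_N→0 (insertion orthogonality catastrophe) occurs for an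
IDEAL bath even with recoil (GuentherEtAl2021 (3),(10)); here the bath is the interacting gas
itself, so Z_N ≥ c presupposes compressibility bounded uniformly in L=(N/ρ)^(1/3) — open, morally as
hard as BEC.) [GuentherEtAl2021, PenroseOnsager1956, Reatto1969, LSSY2005, LampartTriay2025]
#2 StaticResponseBound (crux) — STATIC RESPONSE BOUND (card K1, energy currency; shared input of
cards one-particle-at-a-time / swap-overlap-no-catastrophe): for every repulsive finite-range v
there are ρ₀ > 0 and C such that for 0 < ρ < ρ₀, EVERY N, every k ∈ ℤ³∖0 (p = 2πk/L, L =
(N/ρ)^(1/3)), every coupling t ∈ ℝ and every periodic trial state Ψ of finite energy: ⟨Ψ,(H_N + tΣ_j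
cos(p·x_j))Ψ⟩ ≥ E₀^per(N,L) − C t² N / max(ρa, |p|²), a = scattering length — i.e. the second-order
energy response N m₋₁(p)-type coefficient is ≤ C N/max(ρa,p²) (Bogoliubov: 1/(p²+16πρa)) uniformly
down to p = 2π/L and in N; large |t| is covered by the trivial bound −|t|N, small N by the free
bound C/p² (Mathieu / Temple), if a.toReal = 0 the bound merely weakens to the free form C/p².
Ranked 2 as the most informative item per unit effort: decidable with existing energy technology,
shared by three cards, and its failure kills the line outright. [difficulty: L] (why it might fail:
needs the CURVATURE of E₀(H+tΣcos) in t uniformly in k down to 2π/L and in N at fixed small ρ —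
second differences at LHY precision (LDA + localized Bogoliubov); a long-wavelength density-wave
softening m₋₁(k)·ρa → ∞ along L=(N/ρ)^(1/3) refutes it.) [FournaisSolovej2020, Fournais2020,
doi:10.1007/s00023-021-01151-z, doi:10.1016/j.matpur.2023.06.002, LSSY2005, GuentherEtAl2021]
#3 CorrectorClosure (crux) — StaticResponseBound → InsertionResidue (card K2, the heart and the
hardest step): given the static response bound, the Kipnis–Varadhan corrector hierarchy for ψ = −log
h, h = Ψ_(N+1)/Ψ_N the positive principal eigenfunction of K = −G_N − Δ_y + Σ_j v^per(y−x_j) over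
the ground-state diffusion of the N-gas (weight |Θ|², Θ a positive near-minimiser), converges with
constants uniform in N, L at small ρ in a norm strong enough for Z_N = (E h)²/E h² ≥ c (L² ∩
H¹(|Θ|²dX⊗dy) plus exponential moments of ψ − Eψ); first corrector = Reatto–Chester dressing û₁(p) =
v̂(p)/(e_p + p²); for strong or hard-core v the zeroth order is the pair-dressed amplitude h₀ = Π_j
f(y−x_j) (zero-energy scattering solution, weight |Θ|²h₀²) and the expansion is for log(h/h₀) with
v̂ replaced by the scattering amplitude 8πa + …. [deps: StaticResponseBound] [difficulty: XL] (why
it might fail: 2nd-corrector source |∇χ₁|²−E|∇χ₁|² is a two-mode density functional needing 4-point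
dynamic control not implied by the 2-point bound; Z_N ≥ c needs exponential moments of log h, not
only its variance; hard cores force the pair-dressed zeroth order (Born − μ = ∞).)
[KipnisVaradhan1986, Osada1998, KipnisLandim1999, Spohn1987, DybalskiSpohn2020,
MukherjeeVaradhan2019, GloriaMourrat2013, ReattoChester1967, PistolesiEtAl2004]
#4 BoundaryTransferWeak (crux) — shared verbatim with routes BECNewtonPolicyIteration / (retired)
BECPeriodicReduction, item stmt-AtomisticToContinuum-0827: for each repulsive finite-range v,
PeriodicBEC(v) (constant-mode occupation ≥ cN for δ-near-minimisers of the periodic energy on the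
torus of side (N/ρ)^(1/3), ρ < ρ₀) implies ∃ρ₀>0 ∀ρ∈(0,ρ₀) HasGroundStateBEC v ρ (Dirichlet ground
state, λ_max(γ) ≥ cN). Not glue: Dirichlet/periodic energies differ by a wall term ≫ near-minimiser
slack; expected proof: Neumann bracketing of interior sub-boxes + a mode-free criterion; fallback
for THIS route: rerun the corrector argument in the Dirichlet box with DirichletRemovalBound
(support) and the √ρ̄₁ mode. [difficulty: L] (why it might fail: PeriodicBEC(v) is ground-state-only
(δ after N): the Dirichlet ground state lies a wall term ≫δ above E₀^per and interior restrictions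
are neither periodic nor of sharp N, so the hypothesis may never fire (transfer≈conjunct); BEC is
BC-sensitive for attractive walls (Robinson 1976).) [LSSY2005, Junge2026, Basti2022,
BoccatoSeiringer2023, doi:10.1007/bf01608554]
#9 ResidueCondenses (support) — InsertionResidue → torus BEC of near-minimisers (verbatim the
PeriodicBEC signature of stmt-AtomisticToContinuum-0826 = the hypothesis BoundaryTransferWeak
consumes): unfold condensateOccupation (N+1) L Ψ = (N+1)L⁻³∫_(cell^N)|∫_cell Ψ(x,Y)dx|²dY
(constantMode, cell indicators), Cauchy–Schwarz against the normalised Θ on cell^N gives ≥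
(N+1)L⁻³|overlap|² ≥ c(N+1); shift ∀ᶠ N ↦ N+1 (tendsto_add_atTop). Lean-heavy parts:
Fubini/measurability for C¹ integrands on the cell, Cauchy–Schwarz between ∫⁻ and the Bochner
integral. [difficulty: M] [LSSY2005, PenroseOnsager1956, Fournais2020]
#9 StaticResponseToHMinusOne (support) — THE ENERGY → H₋₁ DICTIONARY (typed Kipnis–Varadhan bridge,
provable now): on a torus of side L > 0, if Θ is a NONNEGATIVE periodic trial state attaining the
periodic ground-state energy (finite) and the energy-currency response bound E₀ − C t² ≤ ⟨Ψ,HΨ⟩ +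
t∫(Σ_j cos(p·x_j))|Ψ|² holds for all t and all finite-energy periodic Ψ (p = 2πk/L), then the
Kipnis–Varadhan H₋₁ norm of g = Σ_j cos(p·x_j) for the weight |Θ| is ≤ C: hMinusOneSqW L |Θ| g ≤ C.
Proof: symmetrise the test function β (the functional 2∫gβΘ² − 𝓔_Θ(β,β) is concave and
permutation-invariant), insert the admissible trial states Ψ_t ∝ (1 − tβ)Θ, use the ground-state
representation ⟨(1−tβ)Θ, (H − E₀)(1−tβ)Θ⟩ = t²∫|∇β|²Θ² (weak Euler–Lagrange equation from
minimality, tested on (1−tβ)²Θ) and ⟨g⟩_Θ² = 0 (forced by the hypothesis at first order), divide by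
t² and let t → 0: 2∫gβΘ² − 𝓔_Θ(β,β) ≤ C, i.e. Kipnis–Landim's variational formula. k = 0 or N = 0
are vacuous/trivial (hypothesis fails, resp. g = 0). This is the first brick of CorrectorClosure's
layer 2 (FirstCorrectorBounds) in the tree's vocabulary. [difficulty: M] [KipnisVaradhan1986,
KipnisLandim1999, Davies1989, LSSY2005]
#9 DirichletRemovalBound (support) — mode-free removal bound in ANY box (operator inequality γ_Φ ≥
(N+1)|g⟩⟨g|, g(y) = ∫ conj Θ(X) Φ(y,X) dX for every normalised N-body Θ): (N+1)∫|g(y)|²dy ≤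
maxOccupation (N+1) Φ for Dirichlet trial states Φ (N+1 bodies) and Θ (N bodies); proof: if g ≠ 0
test maxOccupation with φ = g/‖g‖ and apply Cauchy–Schwarz against Θ in the remaining variables (N =
0: equality 1 ≤ 1; L ≤ 0: empty types). The transfer-free criterion for the Dirichlet rerun of the
line (fallback if BoundaryTransferWeak dies); serves the insertion/swap family of cards.
[difficulty: M] [PenroseOnsager1956, LSSY2005]

TWO-LAYER PLAN. Foreseen glued splits (nothing filed now). CorrectorClosure ⇐ FirstCorrectorBounds
(StaticResponseBound ⇒ sup_N of ‖χ₁‖²_(L²) and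
ε₀ = ‖W̃‖²_(H₋₁) at fixed small ρ: StaticResponseToHMinusOne per density mode + Parseval in y + the
recoil lemma (T+k²)⁻² ≤ (4k²T)⁻¹ for the
product generator; pair-dressed version for hard cores) → HigherCorrectorContraction
(H₋₁/exponential-moment control of centred two-mode
density functionals with recoil resolvents: a 4-point static-response statement, typable as the
curvature of E₀ under a TWO-body cosine
perturbation λΣ_(i<j)cos(k·(x_i−x_j)) plus near-minimiser stability at fixed N) → CorrectorClosure.
StaticResponseBound ⇐ LargeK (k ≳ ℓ_F⁻¹:
Neumann localisation into Fournais boxes where complete BEC and Bogoliubov with an external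
potential are theorems) → SmallK (k ≲ ℓ_F⁻¹:
local density approximation against e(ρ) with e″ ≥ 8πa(1−o(1))) → StaticResponseBound. If
BoundaryTransferWeak is refuted or stalls:
open the Dirichlet rerun as a sibling route (InsertionResidueDirichlet with the GP-profile-weighted
mode, assembled through
DirichletRemovalBound → le_condensateNumber, no transfer).

KILL CRITERIA. ¬InsertionResidue for some admissible v at arbitrarily small ρ (an insertion
orthogonality catastrophe WITH interactions: for every N-body
near-minimiser Θ an (N+1)-near-minimiser nearly orthogonal to φ₀⊗Θ) closes the route
(`refuted:InsertionResidue`) and retires the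
insertion/residue family of cards, not the conjunct. ¬StaticResponseBound (a density-wave softening
m₋₁(k)·min(ρa,k²) unbounded along
L=(N/ρ)^(1/3)) closes the route and wounds cards one-particle-at-a-time /
swap-overlap-no-catastrophe (shared K1); a misstated refutation
(constant/regime bookkeeping, e.g. small-N or a.toReal = 0 artefacts) is repaired as
StaticResponseBoundR, not a pivot.
StaticResponseBound ∧ ¬InsertionResidue refutes CorrectorClosure: close. ¬BoundaryTransferWeak:
pivot to the Dirichlet rerun (sibling route
via DirichletRemovalBound); the torus items survive as PeriodicBEC technology.
¬StaticResponseToHMinusOne would only be a misstatement of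
a support (repair in place, the line is untouched). PeriodicBEC proved elsewhere moots cruxes 2–3
for the conjunct (the route then only
explains Z_N).

NOT DECOMPOSED YET. The function spaces of the corrector hierarchy beyond the first H₋₁ step
(product generator −G_N−Δ_y on Config (N+1), approximate
resolvent correctors instead of C¹ solutions, exponential-moment / L^∞ control needed to pass from
Var log h to Z_N); existence, positivity
and uniqueness of finite-volume torus ground states (Perron–Frobenius; connectivity of the dilute
hard-core configuration space) — needed
only INSIDE the proof of CorrectorClosure, the items are stated over near-minimisers and
existentially in Θ; the pair-dressing h₀ = Π f(y−x_j)
for hard cores and the replacement of v̂ by the scattering amplitude; the exact identity E|∇log h|²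
= ρ_N∫v − μ_N (soft v) and μ_N ≤ ρ_N∫v;
the k-regime split and constants of StaticResponseBound; near-minimiser stability constants (δ below
the finite-volume gaps, consistent
with KineticGapLengthScalesNarrow (3): δ ≪ N/L²); the 1-D diagnostic (first corrector ∫dk m₋₁/k²
divergent, Var log h ∼ log N for
Girardeau) — all layer-2 children or prover-side lemmas (`--supports`).

CHEAPEST FALSIFIER. A refuter's closed-form Bogoliubov computation on the torus of the SECOND
corrector: ‖χ₂‖_(L²) and ⟨src,(H−E₀+q²)⁻¹src⟩ with
src = |∇_yχ₁|² − E|∇_yχ₁|², χ₁ = Σ_j u₁(y−x_j), û₁(p) = v̂(p)/(e_p+p²), e_p = √(p⁴+16πρa p²),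
including the anomalous (u_pv_p) pair
amplitudes — if either grows like log L the contraction step of CorrectorClosure is dead at second
order (only a resummed version could
survive). Planner's power counting: q ≠ 0 part ∝ ρ²∫∫ |p||p−q|/(|p|+|p−q|) × bounded — finite; q = 0
part is a self-averaging bath
functional of size O(1/V); first corrector ‖χ₁‖² = ρ∫|v̂|²S_p(e_p+p²)⁻²d³p/(2π)³ = O(√(ρa³)) (≈
1.8√(ρa³)) finite. Second check (done, passes):
StaticResponseBound at v = 0 must read E(t) ≥ −Ct²N/p²: true with C = 2 (Mathieu ground level a₀(q)
≥ −q²/2, or Temple). Third (lookup):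
is the uniform-in-k static response already a theorem in the GP regime
(doi:10.1007/s00023-021-01151-z, doi:10.1016/j.matpur.2023.06.002)?
If yes, LargeK of the two-layer plan is `known` and only SmallK (LDA) remains.

NUMBERS. Bogoliubov (ħ = 2m = 1, μ = 8πρa): m₋₁(k) = S(k)/e_k = 1/(k² + 16πρa) per particle
(compressibility sum rule at k → 0, f-sum m₁ = k²);
S(k) = k²/e_k; depletion 1 − n₀/N = (8/(3√π))√(ρa³) ≈ 1.50√(ρa³) (LSSY2005 App. A); ‖χ₁‖²_(L²) ≈
√π·√(ρa³) ≈ 1.8√(ρa³) (planner's estimate from the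
region k ≳ ξ⁻¹ with v̂ ≈ 8πa; same order as the depletion); ‖W̃‖²_(H₋₁) ≤ ρ∫|v̂|²m₋₁ d³k/(2π)³ ≈
ρ∫|v̂|²/(2k²) at large k; ε₀ = E|∇log h|² = ρ∫v − μ_N ≈ (ρ/(2π)³)∫|v̂(k)|²/(2k²)d³k (second Born
term) for soft v, = +∞ for hard cores (dressing needed);
Z_Bog = 1 − O(√(ρa³)). Orthogonality benchmarks (GuentherEtAl2021): static impurity in an IDEAL BEC
Z₀ ≈ exp(−αN^(1/3)(k_na)²) (eq. (3));
mobile impurity in the interacting BEC Z = exp(−N_ξ∫|φ̃−1|²) > 0 (eq. (10)). Energy-window ceiling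
of the gap methods: L/a ≲
(ρa³)^(-3/4-η/2) (Junge2026 Cor. 6; barrier KineticGapLengthScalesNarrow), and any window δ >
4π²M²N/L² certifies c ≤ 1/(M+1) (ibid. (3)):
all near-minimiser items here have δ chosen after N. Items at open: 8 (1 target, 3 cruxes, 3
supports, 1 assembly); `closes` has 4 hypotheses.

DEFINITION REQUESTS. None needed for the filed items (PeriodicTrialState, periodicEnergy,
periodicGroundStateEnergy, condensateOccupation, cell, cellN,
sideLength, scatteringLength, TrialState, maxOccupation, HasGroundStateBEC, hMinusOneSqW,
dirichletFormW, IsPeriodicTest all exist in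
Literature.MathematicalPhysics.QuantumManyBody.BoseGas). Foreseen when CorrectorClosure is split: a
product-weight / approximate-corrector
vocabulary on Config (N+1) (weight Θ ⊗ 1, resolvent correctors (λ − L_F)⁻¹g) extending
WeightedCorrector / LangevinGenerator, topic
Summits/AtomisticToContinuum/BoseEinsteinCondensation/Theorems, so that FirstCorrectorBounds can be
an item rather than prose.

Novelty: Searches (2026-08-15, this seat): `lit galaxy search "Kipnis-Varadhan" --star all` (21 rows: RWRE /
homogenisation / KPZ / Langevin
sampling — Kumagai, Bolthausen–Sznitman, Gubinelli–Perkowski, Gu–Mourrat; none quantum, none Bose);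
`lit galaxy search "Bose polaron"
--star all` (18 rows: Lampart arXiv:1909.02430 renormalised Bogoliubov–Fröhlich, RG polaron
arXiv:2105.10801, QMC arXiv:2503.04553 — all
presuppose the condensate); `lit search --source crossref "mobile impurity … orthogonality
catastrophe quasiparticle residue"` (8:
doi:10.1103/physreva.103.013317 = GuentherEtAl2021, doi:10.1103/physrevlett.115.160401,
doi:10.1103/physreva.63.013609); `lit search
--source crossref "rigorous Bose polaron effective mass Kipnis Varadhan CLT"` (8:
doi:10.1007/bf01210789, doi:10.1002/cpa.21858,
doi:10.1214/25-aop1791, doi:10.1103/physrev.111.728); `lit search --source crossref "Bogoliubov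
theory … external potential …"` (10:
doi:10.1007/s00023-021-01151-z, doi:10.1016/j.matpur.2023.06.002, doi:10.4310/acta.2019.v222.n2.a1,
doi:10.1063/5.0089790); `lit frontier
AtomisticToContinuum --since 2022` (30 rows; BEC descendants arXiv:2510.20493, arXiv:2603.20776,
arXiv:2602.16566, arXiv:2605.06844 — all
gap / localisation / trial-state energy, no homogenisation link); `lit bridges AtomisticToContinuum
--cross any` (30 rows, none joins the
Bose roots to KipnisLandim1999); local `lit search --hybrid` unavailable this session (searchd rc
75, twice). Plus the card's four novelty
audits (audit-4/14  [refs: 10.1103/physreva.103.013317, 10.1103/physrevlett.115.160401, 10.1103/physreva.63.013609, 10.1007/bf01210789, 10.1002/cpa.21858, 10.1214/25-aop1791, 10.1103/physrev.111.728, 10.1007/s00023-021-01151-z, 10.1016/j.matpur.2023.06.002, 10.4310/acta.2019.v222.n2.a1, 10.1063/5.0089790, 10.1103/physrevlett.122.183001, 1909.02430, 2105.10801, 2503.04553, 2510.20493, 2603.20776, 2602.16566, 2605.06844, 2004]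

Barriers (technique_class: kipnis-varadhan corrector-expansion perturbation-theory): - technique_class: kipnis-varadhan corrector-expansion perturbation-theory
- Literature.Barriers.AtomisticToContinuum.BogoliubovPerturbationInfrared: applies in spirit to
CorrectorClosure (an expansion at T = 0, d = 3); evaded because every expanded object is a
local-gauge-invariant DENSITY functional of the bath sandwiched by recoil resolvents (ω+k²)⁻¹ and
the hierarchy's nonlinearity is |∇χ|² (derivative vertices p·p′) — no anomalous propagator Σ₁₂ or
phase field is ever formed; the honest residual risk (a log L in the two-mode term) is
CorrectorClosure's stated failure mode and the cheapest falsifier.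
- Literature.Barriers.AtomisticToContinuum.BogoliubovPerturbationInfraredNarrow: places the line on
its NOT-covered side: density-response expansions and derivative couplings — conjunct (2) with s = 2
says vertices vanishing like |k|² make the bubble integrable in d = 3, which is the planner's power
counting for χ₂; conjunct (4) (one Goldstone propagator non-integrable only for d ≤ 1) matches the
built-in dimension test (∫dk m₋₁/k² diverges in d = 1).
- Literature.Barriers.AtomisticToContinuum.KineticGapLengthScales: evaded — no Poincaré/kinetic gap
at any scale; solvability of the corrector equations is H₋₁ (Kipnis–Varadhan) and the only "mass" is
the added particle's recoil k², uniform in L; StaticResponseBound may USE gap technology but only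
inside Fournais boxes (large k), never at the thermodynamic scale.
- Literature.Barriers.AtomisticToContinuum.KineticGapLengthScalesN

History (route lifecycle, newest last):
- 2026-08-25T17:34:28Z · DORMANT — reconciler: no traction for 7.9 d (last activity item-evidence-added at 2026-08-17T19:19:33Z); parked, not closed — `ledger route dormant route-AtomisticToConti (operator:999:2624458)

sub-problem: BoseEinsteinCondensation · status: dormant · opened planner-plancard-AtomisticToContinuum-BoseEin-2a38647a-g2-0 2026-08-15T18:48:24Z · rev 1 · ledger route-AtomisticToContinuum-BECInsertionCorrector
GENERATED by the gate from the ledger (D-0016/17). Provers cite these decls: `theorem foo : Summit.AtomisticToContinuum.BoseEinsteinCondensation.Theses.BECInsertionCorrector.<Decl> := …` in Summits/AtomisticToContinuum/BoseEinsteinCondensation/Theorems/<Name>.lean.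
-/

namespace Summit.AtomisticToContinuum.BoseEinsteinCondensation.Theses.BECInsertionCorrector

open scoped BigOperators Topology Manifold Classical MeasureTheory ProbabilityTheory Matrix InnerProductSpace ComplexConjugate ContinuousMap
open Filter Set Function TopologicalSpace MeasureTheory

attribute [summit_statement] _root_.BoseEinsteinCondensation

/-- item stmt-AtomisticToContinuum-12056 · target · rank 0 · open · by planner
why it might fail: Z_N→0 (insertion orthogonality catastrophe) occurs for an IDEAL bath even with recoil (GuentherEtAl2021 (3),(10)); here the bath is the interacting gas itself, so Z_N ≥ c presupposes compressibility bounded uniformly in L=(N/ρ)^(1/3) — open, morally as hard as BEC.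
sources: GuentherEtAl2021, PenroseOnsager1956, Reatto1969, LSSY2005, LampartTriay2025
[target] X as in § Thesis — uniformly positive zero-momentum insertion overlap |⟨φ₀⊗Θ, Ψ⟩|² ≥ c
between SOME δ-near-minimiser Θ of the periodic N-body energy and EVERY δ-near-minimiser Ψ of the
periodic (N+1)-body energy on the torus of side ((N+1)/ρ)^(1/3), ρ < ρ₀(v), N large (card K3 target
quantity; Bogoliubov: Z_N = 1 − O(√(ρa³))). Existential in Θ (weaker than the retired route's ∀Θ,
immune to N-body ground-state degeneracy; ResidueCondenses needs only one normalised Θ). -/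
@[route_item "route-AtomisticToContinuum-BECInsertionCorrector", crux]
def InsertionResidue : Prop :=
  ∀ v : ℝ → ENNReal, Literature.MathematicalPhysics.QuantumManyBody.BoseGas.IsRepulsiveFiniteRange v → ∃ ρ₀ : ℝ, 0 < ρ₀ ∧ ∀ ρ : ℝ, 0 < ρ → ρ < ρ₀ → ∃ c : ℝ, 0 < c ∧ ∀ᶠ N : ℕ in Filter.atTop, ∃ δ : ENNReal, 0 < δ ∧ ∃ Θ : Literature.MathematicalPhysics.QuantumManyBody.BoseGas.PeriodicTrialState N (Literature.MathematicalPhysics.QuantumManyBody.BoseGas.sideLength ρ (N + 1)), Literature.MathematicalPhysics.QuantumManyBody.BoseGas.periodicEnergy v Θ ≤ Literature.MathematicalPhysics.QuantumManyBody.BoseGas.periodicGroundStateEnergy v N (Literature.MathematicalPhysics.QuantumManyBody.BoseGas.sideLength ρ (N + 1)) + δ ∧ ∀ Ψ : Literature.MathematicalPhysics.QuantumManyBody.BoseGas.PeriodicTrialState (N + 1) (Literature.MathematicalPhysics.QuantumManyBody.BoseGas.sideLength ρ (N + 1)), Literature.MathematicalPhysics.QuantumManyBody.BoseGas.periodicEnergy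 v Ψ ≤ Literature.MathematicalPhysics.QuantumManyBody.BoseGas.periodicGroundStateEnergy v (N + 1) (Literature.MathematicalPhysics.QuantumManyBody.BoseGas.sideLength ρ (N + 1)) + δ → ENNReal.ofReal c ≤ ENNReal.ofReal ((Literature.MathematicalPhysics.QuantumManyBody.BoseGas.sideLength ρ (N + 1) ^ 3)⁻¹) * (‖∫ X in Literature.MathematicalPhysics.QuantumManyBody.BoseGas.cellN N (Literature.MathematicalPhysics.QuantumManyBody.BoseGas.sideLength ρ (N + 1)), conj (Θ.ψ X) * ∫ x in Literature.MathematicalPhysics.QuantumManyBody.BoseGas.cell (Literature.MathematicalPhysics.QuantumManyBody.BoseGas.sideLength ρ (N + 1)), Ψ.ψ (Matrix.vecCons x X)‖₊ : ENNReal) ^ 2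

/-- item stmt-AtomisticToContinuum-12057 · crux · rank 2 · open · by planner
why it might fail: needs the CURVATURE of E₀(H+tΣcos) in t uniformly in k down to 2π/L and in N at fixed small ρ — second differences at LHY precision (LDA + localized Bogoliubov); a long-wavelength density-wave softening m₋₁(k)·ρa → ∞ along L=(N/ρ)^(1/3) refutes it.
sources: FournaisSolovej2020, Fournais2020, doi:10.1007/s00023-021-01151-z, doi:10.1016/j.matpur.2023.06.002, LSSY2005, GuentherEtAl2021
[crux] STATIC RESPONSE BOUND (card K1, energy currency; shared input of cards one-particle-at-a-time
/ swap-overlap-no-catastrophe): for every repulsive finite-range v there are ρ₀ > 0 and C such that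
for 0 < ρ < ρ₀, EVERY N, every k ∈ ℤ³∖0 (p = 2πk/L, L = (N/ρ)^(1/3)), every coupling t ∈ ℝ and every
periodic trial state Ψ of finite energy: ⟨Ψ,(H_N + tΣ_j cos(p·x_j))Ψ⟩ ≥ E₀^per(N,L) − C t² N /
max(ρa, |p|²), a = scattering length — i.e. the second-order energy response N m₋₁(p)-type
coefficient is ≤ C N/max(ρa,p²) (Bogoliubov: 1/(p²+16πρa)) uniformly down to p = 2π/L and in N;
large |t| is covered by the trivial bound −|t|N, small N by the free bound C/p² (Mathieu / Temple),
if a.toReal = 0 the bound merely weakens to the free form C/p². Ranked 2 as the most informative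
item per unit effort: decidable with existing energy technology, shared by three cards, and its
failure kills the line outright. [difficulty: L] -/
@[route_item "route-AtomisticToContinuum-BECInsertionCorrector", crux]
def StaticResponseBound : Prop :=
  ∀ v : ℝ → ENNReal, Literature.MathematicalPhysics.QuantumManyBody.BoseGas.IsRepulsiveFiniteRange v → ∃ ρ₀ : ℝ, 0 < ρ₀ ∧ ∃ C : ℝ, 0 < C ∧ ∀ ρ : ℝ, 0 < ρ → ρ < ρ₀ → ∀ N : ℕ, ∀ k : Fin 3 → ℤ, k ≠ 0 → ∀ t : ℝ, ∀ Ψ : Literature.MathematicalPhysics.QuantumManyBody.BoseGas.PeriodicTrialState N (Literature.MathematicalPhysics.QuantumManyBody.BoseGas.sideLength ρ N), Literature.MathematicalPhysics.QuantumManyBody.BoseGas.periodicEnergy v Ψ ≠ ⊤ → (Literature.MathematicalPhysics.QuantumManyBody.BoseGas.periodicGroundStateEnergy v N (Literature.MathematicalPhysics.QuantumManyBody.BoseGas.sideLength ρ N)).toReal - C * t ^ 2 * N / max (ρ * (Literature.MathematicalPhysics.QuantumManyBody.BoseGas.scatteringLength v).toReal) ((2 * Real.pi / Literature.MathematicalPhysics.QuantumManyBody.BoseGas.sideLength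 ρ N) ^ 2 * ∑ i, (k i : ℝ) ^ 2) ≤ (Literature.MathematicalPhysics.QuantumManyBody.BoseGas.periodicEnergy v Ψ).toReal + t * ∫ X in Literature.MathematicalPhysics.QuantumManyBody.BoseGas.cellN N (Literature.MathematicalPhysics.QuantumManyBody.BoseGas.sideLength ρ N), (∑ j, Real.cos (2 * Real.pi / Literature.MathematicalPhysics.QuantumManyBody.BoseGas.sideLength ρ N * ∑ i, (k i : ℝ) * X j i)) * ‖Ψ.ψ X‖ ^ 2

/-- item stmt-AtomisticToContinuum-12058 · crux · rank 3 · open · by planner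
why it might fail: 2nd-corrector source |∇χ₁|²−E|∇χ₁|² is a two-mode density functional needing 4-point dynamic control not implied by the 2-point bound; Z_N ≥ c needs exponential moments of log h, not only its variance; hard cores force the pair-dressed zeroth order (Born − μ = ∞).
sources: KipnisVaradhan1986, Osada1998, KipnisLandim1999, Spohn1987, DybalskiSpohn2020, MukherjeeVaradhan2019
[crux] StaticResponseBound → InsertionResidue (card K2, the heart and the hardest step): given the
static response bound, the Kipnis–Varadhan corrector hierarchy for ψ = −log h, h = Ψ_(N+1)/Ψ_N the
positive principal eigenfunction of K = −G_N − Δ_y + Σ_j v^per(y−x_j) over the ground-state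
diffusion of the N-gas (weight |Θ|², Θ a positive near-minimiser), converges with constants uniform
in N, L at small ρ in a norm strong enough for Z_N = (E h)²/E h² ≥ c (L² ∩ H¹(|Θ|²dX⊗dy) plus
exponential moments of ψ − Eψ); first corrector = Reatto–Chester dressing û₁(p) = v̂(p)/(e_p + p²);
for strong or hard-core v the zeroth order is the pair-dressed amplitude h₀ = Π_j f(y−x_j)
(zero-energy scattering solution, weight |Θ|²h₀²) and the expansion is for log(h/h₀) with v̂
replaced by the scattering amplitude 8πa + …. [deps: StaticResponseBound] [difficulty: XL] -/
@[route_item "route-AtomisticToContinuum-BECInsertionCorrector", crux]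
def CorrectorClosure : Prop :=
  StaticResponseBound → InsertionResidue

/-- item stmt-AtomisticToContinuum-0827 · crux · rank 4 · open · by planner
why it might fail: PeriodicBEC(v) is ground-state-only (δ after N): the Dirichlet ground state lies a wall term ≫δ above E₀^per and interior restrictions are neither periodic nor of sharp N, so the hypothesis may never fire (transfer≈conjunct); BEC is BC-sensitive for attractive walls (Robinson 1976).
sources: LSSY2005, Junge2026, Basti2022, BoccatoSeiringer2023, doi:10.1007/bf01608554
[crux] BoundaryTransferWeak (mode-free boundary-condition transfer, per potential): for each
repulsive finite-range v, PeriodicBEC(v) implies ∃ρ₀>0 ∀ρ∈(0,ρ₀) HasGroundStateBEC v ρ (Dirichlet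
ground state, λ_max(γ) ≥ cN via condensateNumber). Not glue: near-minimiser slacks are O(N/L²) while
Dirichlet/periodic energies differ by a boundary term ≫ N/L², so no energy-comparison proof;
expected route: Neumann bracketing of interior sub-boxes (−Δ_Dir ≥ ⊕−Δ_Neu, v ≥ 0) + a mode-free
criterion (λ_max ≥ tr γ²/N). Only the ENERGY analogue is in print (LiebSeiringerSolovejYngvason2005
Ch. 2 after (2.8)). v ≡ 0: hypothesis and conclusion both true. -/
@[route_item "route-AtomisticToContinuum-BECInsertionCorrector", crux]
def BoundaryTransferWeak : Prop :=
  ∀ v : ℝ → ENNReal, Literature.MathematicalPhysics.QuantumManyBody.BoseGas.IsRepulsiveFiniteRange v → (∃ ρ₀ : ℝ, 0 < ρ₀ ∧ ∀ ρ : ℝ, 0 < ρ → ρ < ρ₀ → ∃ c : ℝ, 0 < c ∧ ∀ᶠ N : ℕ in Filter.atTop, ∃ δ : ENNReal, 0 < δ ∧ ∀ Ψ : Literature.MathematicalPhysics.QuantumManyBody.BoseGas.PeriodicTrialState N (Literature.MathematicalPhysics.QuantumManyBody.BoseGas.sideLength ρ N), Literature.MathematicalPhysics.QuantumManyBody.BoseGas.periodicEnergy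 v Ψ ≤ Literature.MathematicalPhysics.QuantumManyBody.BoseGas.periodicGroundStateEnergy v N (Literature.MathematicalPhysics.QuantumManyBody.BoseGas.sideLength ρ N) + δ → ENNReal.ofReal (c * N) ≤ Literature.MathematicalPhysics.QuantumManyBody.BoseGas.condensateOccupation N (Literature.MathematicalPhysics.QuantumManyBody.BoseGas.sideLength ρ N) Ψ.ψ) → ∃ ρ₀ : ℝ, 0 < ρ₀ ∧ ∀ ρ : ℝ, 0 < ρ → ρ < ρ₀ → Literature.MathematicalPhysics.QuantumManyBody.BoseGas.HasGroundStateBEC v ρ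

/-- item stmt-AtomisticToContinuum-12059 · support · rank 9 · closed · proved by Summit.AtomisticToContinuum.BoseEinsteinCondensation.Theorems.ResidueCondenses_proof @ 3a6dad086717 (prover) · by planner
sources: LSSY2005, PenroseOnsager1956, Fournais2020
[support] InsertionResidue → torus BEC of near-minimisers (verbatim the PeriodicBEC signature of
stmt-AtomisticToContinuum-0826 = the hypothesis BoundaryTransferWeak consumes): unfold
condensateOccupation (N+1) L Ψ = (N+1)L⁻³∫_(cell^N)|∫_cell Ψ(x,Y)dx|²dY (constantMode, cell
indicators), Cauchy–Schwarz against the normalised Θ on cell^N gives ≥ (N+1)L⁻³|overlap|² ≥ c(N+1);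
shift ∀ᶠ N ↦ N+1 (tendsto_add_atTop). Lean-heavy parts: Fubini/measurability for C¹ integrands on
the cell, Cauchy–Schwarz between ∫⁻ and the Bochner integral. [difficulty: M] -/
@[route_item "route-AtomisticToContinuum-BECInsertionCorrector", crux]
def ResidueCondenses : Prop :=
  InsertionResidue → ∀ v : ℝ → ENNReal, Literature.MathematicalPhysics.QuantumManyBody.BoseGas.IsRepulsiveFiniteRange v → ∃ ρ₀ : ℝ, 0 < ρ₀ ∧ ∀ ρ : ℝ, 0 < ρ → ρ < ρ₀ → ∃ c : ℝ, 0 < c ∧ ∀ᶠ N : ℕ in Filter.atTop, ∃ δ : ENNReal, 0 < δ ∧ ∀ Ψ : Literature.MathematicalPhysics.QuantumManyBody.BoseGas.PeriodicTrialState N (Literature.MathematicalPhysics.QuantumManyBody.BoseGas.sideLength ρ N), Literature.MathematicalPhysics.QuantumManyBody.BoseGas.periodicEnergy v Ψ ≤ Literature.MathematicalPhysics.QuantumManyBody.BoseGas.periodicGroundStateEnergy v N (Literature.MathematicalPhysics.QuantumManyBody.BoseGas.sideLength ρ N) + δ → ENNReal.ofReal (c * N) ≤ Literature.MathematicalPhysics.QuantumManyBody.BoseGas.condensateOccupation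 N (Literature.MathematicalPhysics.QuantumManyBody.BoseGas.sideLength ρ N) Ψ.ψ

/-- item stmt-AtomisticToContinuum-12060 · support · rank 9 · closed · proved by Summit.AtomisticToContinuum.BoseEinsteinCondensation.Theorems.staticResponseToHMinusOne_proof (prover) · by planner
sources: KipnisVaradhan1986, KipnisLandim1999, Davies1989, LSSY2005
[support] THE ENERGY → H₋₁ DICTIONARY (typed Kipnis–Varadhan bridge, provable now): on a torus of
side L > 0, if Θ is a NONNEGATIVE periodic trial state attaining the periodic ground-state energy
(finite) and the energy-currency response bound E₀ − C t² ≤ ⟨Ψ,HΨ⟩ + t∫(Σ_j cos(p·x_j))|Ψ|² holds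
for all t and all finite-energy periodic Ψ (p = 2πk/L), then the Kipnis–Varadhan H₋₁ norm of g = Σ_j
cos(p·x_j) for the weight |Θ| is ≤ C: hMinusOneSqW L |Θ| g ≤ C. Proof: symmetrise the test function
β (the functional 2∫gβΘ² − 𝓔_Θ(β,β) is concave and permutation-invariant), insert the admissible
trial states Ψ_t ∝ (1 − tβ)Θ, use the ground-state representation ⟨(1−tβ)Θ, (H − E₀)(1−tβ)Θ⟩ =
t²∫|∇β|²Θ² (weak Euler–Lagrange equation from minimality, tested on (1−tβ)²Θ) and ⟨g⟩_Θ² = 0 (forced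
by the hypothesis at first order), divide by t² and let t → 0: 2∫gβΘ² − 𝓔_Θ(β,β) ≤ C, i.e.
Kipnis–Landim's variational formula. k = 0 or N = 0 are vacuous/trivial (hypothesis fails, resp. g =
0). This is the first brick of CorrectorClosure's layer 2 (FirstCorrectorBounds) in the tree's
vocabulary. [difficulty: M] -/
@[route_item "route-AtomisticToContinuum-BECInsertionCorrector"]
def StaticResponseToHMinusOne : Prop :=
  ∀ (v : ℝ → ENNReal) (N : ℕ) (L C : ℝ), 0 < L → 0 ≤ C → ∀ (k : Fin 3 → ℤ) (Θ : Literature.MathematicalPhysics.QuantumManyBody.BoseGas.PeriodicTrialState N L), (∀ X, Θ.ψ X = (‖Θ.ψ X‖ : ℂ)) → Literature.MathematicalPhysics.QuantumManyBody.BoseGas.periodicEnergy v Θ = Literature.MathematicalPhysics.QuantumManyBody.BoseGas.periodicGroundStateEnergy v N L → Literature.MathematicalPhysics.QuantumManyBody.BoseGas.periodicEnergy v Θ ≠ ⊤ → (∀ (t : ℝ) (Ψ : Literature.MathematicalPhysics.QuantumManyBody.BoseGas.PeriodicTrialState N L), Literature.MathematicalPhysics.QuantumManyBody.BoseGas.periodicEnergy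 v Ψ ≠ ⊤ → (Literature.MathematicalPhysics.QuantumManyBody.BoseGas.periodicGroundStateEnergy v N L).toReal - C * t ^ 2 ≤ (Literature.MathematicalPhysics.QuantumManyBody.BoseGas.periodicEnergy v Ψ).toReal + t * ∫ X in Literature.MathematicalPhysics.QuantumManyBody.BoseGas.cellN N L, (∑ j, Real.cos (2 * Real.pi / L * ∑ i, (k i : ℝ) * X j i)) * ‖Ψ.ψ X‖ ^ 2) → Literature.MathematicalPhysics.QuantumManyBody.BoseGas.hMinusOneSqW L (fun X => ‖Θ.ψ X‖) (fun X => ∑ j, Real.cos (2 * Real.pi / L * ∑ i, (k i : ℝ) * X j i)) ≤ ENNReal.ofReal C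

/-- item stmt-AtomisticToContinuum-12061 · support · rank 9 · closed · proved by Summit.AtomisticToContinuum.BoseEinsteinCondensation.Theorems.DirichletRemovalBound_proof (prover) · by planner
sources: PenroseOnsager1956, LSSY2005
[support] mode-free removal bound in ANY box (operator inequality γ_Φ ≥ (N+1)|g⟩⟨g|, g(y) = ∫ conj
Θ(X) Φ(y,X) dX for every normalised N-body Θ): (N+1)∫|g(y)|²dy ≤ maxOccupation (N+1) Φ for Dirichlet
trial states Φ (N+1 bodies) and Θ (N bodies); proof: if g ≠ 0 test maxOccupation with φ = g/‖g‖ and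
apply Cauchy–Schwarz against Θ in the remaining variables (N = 0: equality 1 ≤ 1; L ≤ 0: empty
types). The transfer-free criterion for the Dirichlet rerun of the line (fallback if
BoundaryTransferWeak dies); serves the insertion/swap family of cards. [difficulty: M] -/
@[route_item "route-AtomisticToContinuum-BECInsertionCorrector"]
def DirichletRemovalBound : Prop :=
  ∀ (N : ℕ) (L : ℝ) (Φ : Literature.MathematicalPhysics.QuantumManyBody.BoseGas.TrialState (N + 1) L) (Θ : Literature.MathematicalPhysics.QuantumManyBody.BoseGas.TrialState N L), ((N : ENNReal) + 1) * ∫⁻ y, (‖∫ X, conj (Θ.ψ X) * Φ.ψ (Matrix.vecCons y X)‖₊ : ENNReal) ^ 2 ≤ Literature.MathematicalPhysics.QuantumManyBody.BoseGas.maxOccupation (N + 1) Φ.ψ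

/-- item stmt-AtomisticToContinuum-12062 · assembly · rank 1 · closed · proved by Summit.AtomisticToContinuum.BoseEinsteinCondensation.Theorems.Assembly_proof @ 582e587ef5f7 (prover) · by planner
sources: LSSY2005, PenroseOnsager1956
[assembly] StaticResponseBound → CorrectorClosure → ResidueCondenses → BoundaryTransferWeak →
BoseEinsteinCondensation (the sub-problem Statement). -/
@[route_item "route-AtomisticToContinuum-BECInsertionCorrector"]
def Assembly : Prop :=
  StaticResponseBound → CorrectorClosure → ResidueCondenses → BoundaryTransferWeak → _root_.BoseEinsteinCondensation

/-! D-0027 §2.1 — DECIDING THEOREM (planner-authored via `route open/edit --closes-file`; by planner-plancard-AtomisticToContinuum-BoseEin-2a38647a-g2-0 2026-08-15T18:48:25Z):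
its hypotheses are this route's items and its conclusion the sub-problem Statement (glue_lint), and it elaborates with this file. -/

@[closes "route-AtomisticToContinuum-BECInsertionCorrector"] theorem closes (h₁ : StaticResponseBound) (h₂ : CorrectorClosure) (h₃ : ResidueCondenses)
    (h₄ : BoundaryTransferWeak) : _root_.BoseEinsteinCondensation :=
  fun v hv => h₄ v hv (h₃ (h₂ h₁) v hv)

end Summit.AtomisticToContinuum.BoseEinsteinCondensation.Theses.BECInsertionCorrector
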